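import Summits.BirchSwinnertonDyer.BirchSwinnertonDyer.Theorems.EisensteinPrimesMazurMCOnCellBTwistbackTwoStepShaUnitLevel
import Summits.BirchSwinnertonDyer.BirchSwinnertonDyer.Theorems.EisensteinPrimesMazurMCOnCellBTwistbackOnePartnerAt
import Summits.BirchSwinnertonDyer.Rank1Residual.X2.IsogenyClassStability
import Literature.NumberTheory.EllipticCurves.IsogenyConductorModularityProofs
import HarnessLib

/-!
# Crux 3 `MazurMCOnCellB` (stmt-BirchSwinnertonDyer-19033), line `twistback` v7 — ROAD (e) «TWO-STEP Ш-UNIT» READ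
# ISOGENY-INVARIANTLY: the two-step datum may sit at ANY curve `W₀` ℚ-isogenous to the X2b curve `W`, and the unit
# `ord_p #Ш_an = 0` may be read at ANY globally minimal curve `W‴` ℚ-isogenous to the double twist `W″`

Width seat bsd-line-x2-p1-w5 (gen 3), cell `bsd-eis`, 2026-08-28; `--supports stmt-BirchSwinnertonDyer-19033 --as helper`.
THEOREMS ONLY (no `def`, no named fact introduced, no `sorry`); closes no registered stub; no summit statement, no Mazur main
conjecture and no BSD is proved for any curve unconditionally; 0 cells / labels / stubs / tiers move.

WHY (numbers, seat evidence `ROAD-E-WITNESS-A10-w5g3.md`, evidence #51 on -19033). The registered v7 stub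
`stub_upperPartnerOffSubrowNoUnitEnd` excludes an X2b pair `(W, p)` when `W` ITSELF carries the two-step datum of w6 g2's
p662647 — admissible `K`, a minimal model `Wd` of `W^{(d_K)}`, admissible `K″`, a minimal model `W″` of `Wd^{(d_{K″})}`, and
`ord_p #Ш_an(W″) = 0` read AT `W″`. On the first TARGET cells where the datum was computed (70971a1, 163461d1 at `p = 3`),
EVERY unit path has `ord₃ #Ш_an = 0` at the double twist of the A10 member and `ord₃ #Ш_an = 2` at the double twist of its
`3`-isogenous partner (`#T: 3 → 1`, Tamagawa `9 → 3`): so `(70971a2, 3)` is NOT excluded by those paths although its main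
conjecture follows from the member-1 datum by isogeny invariance. This file is the door that makes the exclusion an
ISOGENY-CLASS property, composing tree theorems only:
* §1 `bsdp_of_isIsogenous_shaAnUnit_rankZero` — at a rank-zero X2 curve `W″`, `BSD_p` from a `p`-adic unit `#Ш_an(W‴)` read at
  ANY globally minimal `W‴ ∼ W″` (Wuthrich 2014 Prop. 21 at `W‴`: `…bsdp_of_L_one_ne_zero_of_padicValRat_shaAn_eq_zero`;
  Cassels back to `W″`: `X2.bsdp_of_isIsogenous_of_bsdp`; `X2` data move along the isogeny by `X2.classX2_iff_of_isIsogenous`).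
* §2 `bsdp_of_cellB_of_isIsogenous_twoStepShaUnit` / `mazurMainConjectureAt_of_cellB_of_isIsogenous_twoStepShaUnit` — at an
  X2b pair `(W, p)`: a curve `W₀ ∼ W` (globally minimal; `X2.CellB` transported by `X2.cellB_iff_of_isIsogenous`, the Tate
  facts `_holds`; `N_{W₀} = N_W` by `conductorNorm_eq_of_isIsogenous_of_modularity_of_isGloballyMinimal`, so `K`, `K″`
  admissible for `W` are admissible for `W₀`) with the two-step datum whose unit is read at `W‴ ∼ W″` gives `BSDp W p`
  (w6 g2's `bsdp_of_cellB_of_twoStepBSDp`, p663790, at `W₀`; Cassels `W₀ ∼ W`) and `X2.MazurMainConjectureAt W p`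
  (`X2.mazurMainConjectureAt_of_bsdp_of_red`). The second field's admissibility is stated on `N_W`, `p`, `|d_K|` as in
  p664945 (`satisfiesHeegnerHypothesis_conductorNorm_twist`).
FOR THE NEXT LEAD (W-79; said, not filed): a v8 that negates THIS datum instead of p662647's («∃ W₀ ∼ W, …, ∃ W‴ ∼ W″ with
`ord_p #Ш_an(W‴) = 0`») excludes whole isogeny classes at once; the derived branch is §2 fed BY NAME exactly like
`upperPartner_ofUnitEnd` (same named facts: `PublishedInputs`, Wuthrich Prop. 21, Poitou–Tate ×2, Hsieh, LZZ, Mazur 4.1, Keller–Yin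
Thm. D) — except that it concludes the MAIN CONJECTURE / `BSDp` at `(W, p)` rather than the ∃-PARTNER clause, so it belongs in
the composition `MazurMCOnCellB_of` as a case split before the partner road (like a distance-0 anchor `p ∤ #Ш_an(W)`, which is
the special case `W₀ = W‴ = W` of nothing here but of `X2.mazurMainConjectureAt_of_shaAn_unit_of_red`).

References: [Wuthrich2014] Thm. 16, Prop. 21; [KellerYin2024] Thm. D (PRE); [LiuZhangZhang2018] Thms. 1.5.1/1.5.3; [Hsieh2014]
Thm. 1; [Mazur1978] Cor. 4.1; [MilneADT2006] Thm. I.7.3 (Cassels); [SilvermanATAEC1994] Thm. V.5.3, Cor. V.5.4;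
[GrossLMS1991] §1; [CastellaEtAl2021] Thm. 5.3.1.
-/

set_option autoImplicit false

-- `Summit.BirchSwinnertonDyer.BirchSwinnertonDyer.…`: the summit and its single sub-problem share a name.
set_option linter.dupNamespace false

noncomputable section

open scoped Classical

open WeierstrassCurve NumberField
  Literature.NumberTheory.EllipticCurves
  Literature.NumberTheory.EllipticCurves.ModularForms
  Literature.NumberTheory.QuadraticFields
  Literature.NumberTheory.EllipticCurves.Rank1Residual
  Literature.NumberTheory.EllipticCurves.Rank1Residual.Typed
  Literature.NumberTheory.EllipticCurves.Wuthrich2014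
  Literature.NumberTheory.EllipticCurves.SteinWuthrich2013
  Literature.NumberTheory.EllipticCurves.KellerYin2024
  Literature.NumberTheory.GaloisCohomology
  Summit.BirchSwinnertonDyer.Rank1Residual
  Summit.BirchSwinnertonDyer.BirchSwinnertonDyer.Theses
  Summit.BirchSwinnertonDyer.BirchSwinnertonDyer.Theorems.EisensteinPrimesMazurMCOnCellBTwistbackOnePartnerAt
  Summit.BirchSwinnertonDyer.BirchSwinnertonDyer.Theorems.EisensteinPrimesMazurMCOnCellBTwistbackTwoStepShaUnitLevel

namespace Summit.BirchSwinnertonDyer.BirchSwinnertonDyer.Theorems.EisensteinPrimesMazurMCOnCellBTwistbackTwoStepShaUnitIsogenous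

/-! ## §1. The rank-zero end: `BSD_p` from a unit read at an isogenous curve -/

/-- **`BSD(W″, p)` at a rank-zero X2 curve from `ord_p #Ш_an(W‴) = 0` at ANY globally minimal `W‴ ∼ W″`.** Data: `W″`
X2 at `p` (`p ≠ 2`, `E[p]` reducible, `p` multiplicative) with `L(W″, 1) ≠ 0`; `W‴` globally minimal, ℚ-isogenous to `W″`,
with `#Ш_an(W‴)` a rational `p`-adic unit. Then `W‴` is X2 at `p` (`X2.classX2_iff_of_isIsogenous`) of analytic rank `0`
(`analyticRank_eq_of_isIsogenous'`), `BSDp W‴ p` by Wuthrich 2014 Prop. 21 (+ Thm. 16 for the reducible image: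
`Wuthrich2014.bsdp_of_L_one_ne_zero_of_padicValRat_shaAn_eq_zero`), and `BSDp W″ p` by Cassels
(`X2.bsdp_of_isIsogenous_of_bsdp`). Named facts BY NAME: `PublishedInputs` (Cassels, newforms, GZK), Wuthrich Prop. 21.
CONDITIONAL on them. [cite: Wuthrich2014, Prop. 21 (p. 400) and Thm. 16 (p. 397)] [cite: MilneADT2006, Thm. I.7.3] -/
theorem bsdp_of_isIsogenous_shaAnUnit_rankZero (hP : EisensteinPrimes.PublishedInputs) (hW21 : sha_dvd_analyticSha)
    (W'' : WeierstrassCurve ℚ) [W''.IsElliptic] [W''.IsGloballyMinimal] (p : ℕ) [Fact p.Prime] (hX'' : ClassX2 W'' p)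
    (hL'' : W''.entireLFunction 1 ≠ 0)
    (W''' : WeierstrassCurve ℚ) [W'''.IsElliptic] [W'''.IsGloballyMinimal] (hiso : IsIsogenous W''' W'')
    (hunit : ∃ q : ℚ, shaAn W''' = (q : ℂ) ∧ padicValRat p q = 0) : BSDp W'' p := by
  have hCassels := hP.2.1
  have hnf := hP.2.2.2.2.2.1
  have hGZK := hP.2.2.2.2.2.2.2.2.2.2.1
  have hE : WeierstrassCurve.hasEntireLFunction_rat :=
    WeierstrassCurve.hasEntireLFunction_rat_of_exists_isNewformOf hnf
  have hX''' : ClassX2 W''' p := (X2.classX2_iff_of_isIsogenous hiso).mpr hX''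
  have hr'' : W''.analyticRank = 0 := (W''.analyticRank_eq_zero_iff_holds (hE W'')).2 hL''
  have hr''' : W'''.analyticRank = 0 := by rw [analyticRank_eq_of_isIsogenous' hiso]; exact hr''
  have hL''' : W'''.entireLFunction 1 ≠ 0 := (W'''.analyticRank_eq_zero_iff_holds (hE W''')).1 hr'''
  have hbsd''' : BSDp W''' p :=
    Wuthrich2014.bsdp_of_L_one_ne_zero_of_padicValRat_shaAn_eq_zero hW21 hGZK W''' p hX'''.1 hL'''
      (WeierstrassCurve.HasMultiplicativeReduction.not_hasAdditiveReduction _ hX'''.2.2) (Or.inl hX'''.2.1) hunit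
  exact X2.bsdp_of_isIsogenous_of_bsdp hCassels hGZK hE W''' W'' hiso p (by rw [hr''']; exact zero_le_one) hbsd'''

/-! ## §2. The X2b pair: the datum at an isogenous curve, the unit at an isogenous end -/

/-- **PER PAIR, ISOGENY-INVARIANT ROAD (e): `BSD(E, p)` at an X2b pair `(W, p)` from a two-step Ш-unit datum placed at ANY
globally minimal `W₀ ∼ W`, with the unit read at ANY globally minimal `W‴ ∼ W″`.** Data: `hc : X2.CellB W p`;
`W₀` ℚ-isogenous to `W` (`IsIsogenous W₀ W`); `K` imaginary quadratic, Heegner for `N_W` and for `p`, `d_K` odd `< −4`,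
with `ord_{s=1} L(E₀^{(d_K)}, s) = 1`; `Wd` a globally minimal model of `E₀^{(d_K)}`; `K″` imaginary quadratic, `d_{K″}`
odd `< −4`, Heegner for `N_W`, for `|d_K|` and for `p`, with `L(Wd^{(d_{K″})}, 1) ≠ 0`; `W″` a globally minimal model of
`Wd^{(d_{K″})}`; `W‴` globally minimal with `IsIsogenous W‴ W″` and `#Ш_an(W‴)` a rational `p`-unit. Conclusion `BSDp W p`:
`X2.CellB W₀ p` (`X2.cellB_iff_of_isIsogenous`, Tate uniformisation `_holds`), `N_{W₀} = N_W`
(`conductorNorm_eq_of_isIsogenous_of_modularity_of_isGloballyMinimal`), `W″` is X2 at `p` (`X2.classX2_twist` twice), §1 at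
`(W″, W‴)`, w6 g2's `bsdp_of_cellB_of_twoStepBSDp` at `W₀` (Heegner for `N_{Wd}` by `satisfiesHeegnerHypothesis_conductorNorm_twist`),
Cassels `W₀ ∼ W`. Named facts BY NAME: `PublishedInputs`, Wuthrich Prop. 21, Poitou–Tate ×2, Hsieh 2014 Thm. 1, LZZ 2018,
Mazur Cor. 4.1 (PUBLISHED), Keller–Yin Thm. D (PREPRINT). CONDITIONAL; nothing class-wide is claimed.
[claim: KellerYin2024, status: under-review] [cite: KellerYin2024, Thm. D = Thm. 5.1.3 (arXiv:2402.12781v2 L306–L309)]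
[cite: Wuthrich2014, Prop. 21 (p. 400) and Thm. 16 (p. 397)] [cite: MilneADT2006, Thm. I.7.3] [cite: GrossLMS1991, §1 (p. 235)]
[cite: SilvermanATAEC1994, Thm. V.5.3 and Cor. V.5.4] [cite: Miller2011LMS, Def. 1.1] -/
theorem bsdp_of_cellB_of_isIsogenous_twoStepShaUnit (hP : EisensteinPrimes.PublishedInputs) (hW21 : sha_dvd_analyticSha)
    (hPT : ∀ (K : Type) [Field K] [NumberField K], poitouTate_selmerStructure_duality K)
    (hPT2 : ∀ (K : Type) [Field K] [NumberField K], poitouTate_sha_tateDual K)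
    (hH : hsieh2014_exists_anticyclotomicPAdicLFunction)
    (hF : LiuZhangZhang2018.thm151_thm153_modularCurve_heegnerVector) (hMaz : mazur_not_dvd_maninConstant_of_odd)
    (hD : KellerYin2024.thmD_imcMult_exists_isBDPLFunction_isTorsion_charIdeal_eq_OPEN)
    (W : WeierstrassCurve ℚ) [W.IsElliptic] [W.IsGloballyMinimal] (p : ℕ) [Fact p.Prime] (hc : X2.CellB W p)
    (W₀ : WeierstrassCurve ℚ) [W₀.IsElliptic] [W₀.IsGloballyMinimal] (hiso₀ : IsIsogenous W₀ W)
    (K : Type) [Field K] [NumberField K] (hK : IsImaginaryQuadratic K)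
    (hHN : SatisfiesHeegnerHypothesis (W.conductorNorm ℤ) K) (hHp : SatisfiesHeegnerHypothesis p K)
    (hoddK : Odd (NumberField.discr K)) (hlt : NumberField.discr K < -4)
    (hr1 : (W₀.quadraticTwist (NumberField.discr K : ℚ)).analyticRank = 1)
    (Wd : WeierstrassCurve ℚ) [Wd.IsElliptic] [Wd.IsGloballyMinimal]
    (hWd : ∃ C : VariableChange ℚ, C • Wd = W₀.quadraticTwist (NumberField.discr K : ℚ))
    (K'' : Type) [Field K''] [NumberField K''] (hK'' : IsImaginaryQuadratic K'')
    (hodd'' : Odd (NumberField.discr K'')) (hlt'' : NumberField.discr K'' < -4)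
    (hHN'' : SatisfiesHeegnerHypothesis (W.conductorNorm ℤ) K'')
    (hHd'' : SatisfiesHeegnerHypothesis (NumberField.discr K).natAbs K'') (hHp'' : SatisfiesHeegnerHypothesis p K'')
    (hL'' : (Wd.quadraticTwist (NumberField.discr K'' : ℚ)).entireLFunction 1 ≠ 0)
    (W'' : WeierstrassCurve ℚ) [W''.IsElliptic] [W''.IsGloballyMinimal]
    (hW'' : ∃ C : VariableChange ℚ, C • W'' = Wd.quadraticTwist (NumberField.discr K'' : ℚ))
    (W''' : WeierstrassCurve ℚ) [W'''.IsElliptic] [W'''.IsGloballyMinimal] (hiso : IsIsogenous W''' W'')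
    (hunit : ∃ q : ℚ, shaAn W''' = (q : ℂ) ∧ padicValRat p q = 0) : BSDp W p := by
  have hCassels := hP.2.1
  have hpar := hP.2.2.2.2.1
  have hnf := hP.2.2.2.2.2.1
  have hGZK := hP.2.2.2.2.2.2.2.2.2.2.1
  have hE : WeierstrassCurve.hasEntireLFunction_rat :=
    WeierstrassCurve.hasEntireLFunction_rat_of_exists_isNewformOf hnf
  ---------------------------------------------------------------- the datum's base `W₀ ∼ W` is an X2b pair with `N_{W₀} = N_W`
  have hc₀ : X2.CellB W₀ p :=
    (X2.cellB_iff_of_isIsogenous (p := p) TateCurve.Silverman1994_thmV53_tateUniformisation_holds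
      TateCurve.Silverman1994_thmV53_corV54_tateUniformisation_holds hiso₀).mpr hc
  have hN : W₀.conductorNorm ℤ = W.conductorNorm ℤ :=
    conductorNorm_eq_of_isIsogenous_of_modularity_of_isGloballyMinimal hpar hiso₀
  have hHN₀ : SatisfiesHeegnerHypothesis (W₀.conductorNorm ℤ) K := by rw [hN]; exact hHN
  have hHN''₀ : SatisfiesHeegnerHypothesis (W₀.conductorNorm ℤ) K'' := by rw [hN]; exact hHN''
  ---------------------------------------------------------------- Heegner for `N_{Wd}` from `N_W` and `|d_K|`
  obtain ⟨C, hC⟩ := hWd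
  have hd4 : NumberField.discr K % 4 = 1 := Quadratic.discr_emod_four_eq_one hK.1 hoddK
  have hHNd'' : SatisfiesHeegnerHypothesis (Wd.conductorNorm ℤ) K'' :=
    satisfiesHeegnerHypothesis_conductorNorm_twist W₀ hd4 Wd C hC hHN''₀ hHd''
  ---------------------------------------------------------------- the rank-zero end `W″` and the unit at `W‴ ∼ W″`
  have hXd : ClassX2 Wd p := X2.classX2_twist W₀ p hc₀.2.1 K hK hHp Wd ⟨C, hC⟩
  have hX'' : ClassX2 W'' p := X2.classX2_twist Wd p hXd K'' hK'' hHp'' W'' hW''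
  obtain ⟨C'', hC''⟩ := hW''
  have hL1 : W''.entireLFunction 1 ≠ 0 := by
    rw [← entireLFunction_smul W'' C'', hC'']; exact hL''
  have hbsd'' : BSDp W'' p :=
    bsdp_of_isIsogenous_shaAnUnit_rankZero hP hW21 W'' p hX'' hL1 W''' hiso hunit
  ---------------------------------------------------------------- two-step transfer at `W₀`, Cassels to `W`
  have hbsd₀ : BSDp W₀ p :=
    bsdp_of_cellB_of_twoStepBSDp hP hPT hPT2 hH hF hMaz hD W₀ p hc₀ K hK hHN₀ hHp hoddK hlt hr1 Wd ⟨C, hC⟩ K'' hK''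
      hodd'' hlt'' hHNd'' hHp'' hL'' W'' ⟨C'', hC''⟩ hbsd''
  exact X2.bsdp_of_isIsogenous_of_bsdp hCassels hGZK hE W₀ W hiso₀ p (by rw [hc₀.1]; exact zero_le_one) hbsd₀

/-- **PER PAIR, ISOGENY-INVARIANT ROAD (e): Mazur's main conjecture at an X2b pair `(W, p)`** from the data of
`bsdp_of_cellB_of_isIsogenous_twoStepShaUnit` — `BSDp W p` there, then the rank-zero converse
`X2.mazurMainConjectureAt_of_bsdp_of_red` (Wuthrich Thm. 16, Stein–Wuthrich Thm. 6.1 with the canonical heights, GZK,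
Greenberg–Stevens, modularity — all `PublishedInputs` conjuncts). CONDITIONAL; a main conjecture is proved for no curve by this.
[claim: KellerYin2024, status: under-review] [cite: Wuthrich2014, Thm. 16 (p. 397) and Prop. 21 (p. 400)]
[cite: SteinWuthrich2013, Thm. 6.1 (p. 20) and §4.2] [cite: MilneADT2006, Thm. I.7.3] [cite: Miller2011LMS, Def. 1.1] -/
theorem mazurMainConjectureAt_of_cellB_of_isIsogenous_twoStepShaUnit (hP : EisensteinPrimes.PublishedInputs)
    (hW21 : sha_dvd_analyticSha)
    (hPT : ∀ (K : Type) [Field K] [NumberField K], poitouTate_selmerStructure_duality K)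
    (hPT2 : ∀ (K : Type) [Field K] [NumberField K], poitouTate_sha_tateDual K)
    (hH : hsieh2014_exists_anticyclotomicPAdicLFunction)
    (hF : LiuZhangZhang2018.thm151_thm153_modularCurve_heegnerVector) (hMaz : mazur_not_dvd_maninConstant_of_odd)
    (hD : KellerYin2024.thmD_imcMult_exists_isBDPLFunction_isTorsion_charIdeal_eq_OPEN)
    (W : WeierstrassCurve ℚ) [W.IsElliptic] [W.IsGloballyMinimal] (p : ℕ) [Fact p.Prime] (hc : X2.CellB W p)
    (W₀ : WeierstrassCurve ℚ) [W₀.IsElliptic] [W₀.IsGloballyMinimal] (hiso₀ : IsIsogenous W₀ W)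
    (K : Type) [Field K] [NumberField K] (hK : IsImaginaryQuadratic K)
    (hHN : SatisfiesHeegnerHypothesis (W.conductorNorm ℤ) K) (hHp : SatisfiesHeegnerHypothesis p K)
    (hoddK : Odd (NumberField.discr K)) (hlt : NumberField.discr K < -4)
    (hr1 : (W₀.quadraticTwist (NumberField.discr K : ℚ)).analyticRank = 1)
    (Wd : WeierstrassCurve ℚ) [Wd.IsElliptic] [Wd.IsGloballyMinimal]
    (hWd : ∃ C : VariableChange ℚ, C • Wd = W₀.quadraticTwist (NumberField.discr K : ℚ))
    (K'' : Type) [Field K''] [NumberField K''] (hK'' : IsImaginaryQuadratic K'')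
    (hodd'' : Odd (NumberField.discr K'')) (hlt'' : NumberField.discr K'' < -4)
    (hHN'' : SatisfiesHeegnerHypothesis (W.conductorNorm ℤ) K'')
    (hHd'' : SatisfiesHeegnerHypothesis (NumberField.discr K).natAbs K'') (hHp'' : SatisfiesHeegnerHypothesis p K'')
    (hL'' : (Wd.quadraticTwist (NumberField.discr K'' : ℚ)).entireLFunction 1 ≠ 0)
    (W'' : WeierstrassCurve ℚ) [W''.IsElliptic] [W''.IsGloballyMinimal]
    (hW'' : ∃ C : VariableChange ℚ, C • W'' = Wd.quadraticTwist (NumberField.discr K'' : ℚ))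
    (W''' : WeierstrassCurve ℚ) [W'''.IsElliptic] [W'''.IsGloballyMinimal] (hiso : IsIsogenous W''' W'')
    (hunit : ∃ q : ℚ, shaAn W''' = (q : ℂ) ∧ padicValRat p q = 0) : X2.MazurMainConjectureAt W p := by
  have hnf := hP.2.2.2.2.2.1
  have hGZK := hP.2.2.2.2.2.2.2.2.2.2.1
  have hWu := hP.2.2.2.2.2.2.2.2.2.2.2.2.2.2.1
  have hJs := hP.2.2.2.2.2.2.2.2.2.2.2.2.2.2.2.1
  have hJn := hP.2.2.2.2.2.2.2.2.2.2.2.2.2.2.2.2.1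
  have hHs := hP.2.2.2.2.2.2.2.2.2.2.2.2.2.2.2.2.2.1
  have hHn := hP.2.2.2.2.2.2.2.2.2.2.2.2.2.2.2.2.2.2.1
  have hGS := hP.2.2.2.2.2.2.2.2.2.2.2.2.2.2.2.2.2.2.2
  have hE : WeierstrassCurve.hasEntireLFunction_rat :=
    WeierstrassCurve.hasEntireLFunction_rat_of_exists_isNewformOf hnf
  exact X2.mazurMainConjectureAt_of_bsdp_of_red hWu hJs hJn hHs hHn hGZK hE W p (hGS W p) hc.2.1.1 hc.2.1.2.2
    hc.2.1.2.1 hc.1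
    (bsdp_of_cellB_of_isIsogenous_twoStepShaUnit hP hW21 hPT hPT2 hH hF hMaz hD W p hc W₀ hiso₀ K hK hHN hHp hoddK
      hlt hr1 Wd hWd K'' hK'' hodd'' hlt'' hHN'' hHd'' hHp'' hL'' W'' hW'' W''' hiso hunit)

end Summit.BirchSwinnertonDyer.BirchSwinnertonDyer.Theorems.EisensteinPrimesMazurMCOnCellBTwistbackTwoStepShaUnitIsogenous

end
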